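import Mathlib.Analysis.SpecificLimits.Normed
import HarnessLib

/-!
# Route `UnitScaleTilt`, crux K1 «MinimiserStabilityRegPr» (stmt-QuantumFields-19200), route-R E′ path (α′), rows (E1-d)∕(E1-e) of LOCATE-E1-CONTRACTION:
# THE EXACT CORRECTOR'S CONTRACTION IN GAUGE CURRENCY — the INSTANCE-FREE twin of `Prop7ExactCorrectorContraction.exists_unique_exact_corrector`

Cell `ym3-torus`, width seat `ym3-torus-px13` (gen 3); offer «px13: (E1-d′) GAUGE-CURRENCY CONTRACTION DOOR» (bus 2026-08-28T20:49Z) answering ★routeR-w3 g5 20:46:27Z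
«the finite-dimensional `X` with the max-of-three-sup-rows norm is a `NormedAddCommGroup`∕`NormedSpace ℝ` instance the (E1-e) knit must provide … or keep (E1-d) at the level of
the three separate sup quantities by a hand iteration; I flag this as the one typing risk of (E1-e)».
THEOREMS ONLY (0 `def`, 0 `sorry`, 0 `instance`); `--supports stmt-QuantumFields-19200`, count-neutral.  YM₃ on T³ is a ladder rung (R3), not the Clay problem; nothing here
claims the stub, the crux, d = 4 or the gap.  Pure functional analysis; no lattice object appears.

WHY THIS FILE.  The door of record `exists_unique_exact_corrector` (ym-routeR-w3 g5) measures the ball, the Lipschitz moduli and the contraction in the INSTANCE norm of `X`.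
The (E1-e) knit's `X`-currency is `‖ψ‖_X := max(sup‖ψ‖, ℓ·sup‖D_Wψ‖, ℓ²·sup‖Δ_Wψ‖)` on pinned Herm-tr0 site fields — NOT the `Pi`∕sup instance norm of the site-field type —
and a def-free Theorems file can declare neither a `NormedAddCommGroup` instance nor a type synonym.  Here the instance norm of `X` (whatever complete norm the site-field
type already carries) is used ONLY to take the limit of the Picard sequence; ball, moduli and contraction are measured in a BARE GAUGE `p : X → ℝ` (the knit passes the
max of its three sup rows as a plain function) and a bare `q : Y → ℝ` on a mere `AddCommGroup Y` (bond fields; no norm or module structure on `Y` is used), under the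
displayed, knit-dischargeable rows
* `hp_tri : p (a − c) ≤ p (a − b) + p (b − c)` (triangle), `hp_norm : ‖x‖ ≤ p x` (the first sup row dominates the instance norm), `hp_le : p x ≤ C_p·‖x‖` (continuity of
  the gauge; `C_p = max(1, 2ℓ, 4dℓ²)`-class for unitary `W`);
* `L : Y →+ X` additive (the knit passes `LinCorr` as an `AddMonoidHom`), `hL : p (L y) ≤ C_L·q y` (= (hK₀)(hK)(hK₂)), `hLS : L y ∈ S` for an invariant CLOSED set `S`
  (pinned ∧ Hermitian ∧ traceless; `IsClosed` from `Submodule.closed_of_finiteDimensional` or three `isClosed_eq`s), on which alone the `N`-row is asked;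
* `hN0 : N 0 = 0`, `hN : ψ, ψ′ ∈ S → p ψ, p ψ′ ≤ 3C_L s → q (N ψ − N ψ′) ≤ C_N (p ψ + p ψ′ + s)·p (ψ − ψ′)` (= (E1-c) + px15's C¹ letters), `hD : q D ≤ s`;
* the SAME window `C_L·C_N·(7C_L s + s) ≤ 1∕2` and the SAME conclusion shape as the door of record, plus `ψ ∈ S`.

WHAT IS PROVED (ns `…Theorems.Prop7ExactCorrectorContractionGauge`; `X` a complete normed additive group, `Y` an additive group).
* `gauge_zero`, `gauge_nonneg`, `gauge_add_le` — bookkeeping of a gauge squeezed between `‖·‖` and `C_p‖·‖`.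
* `gauge_apply_N_le` — `q (N ψ) ≤ C_N (p ψ + s)·p ψ` from the Lipschitz row at `ψ′ = 0` (the knit's output row for `‖N(ψ)‖_Y`); `gauge_sub_linear_le` —
  `p (ψ − L D) ≤ C_L·C_N·(ρ + s)·ρ` for any solution in `S ∩ {p ≤ ρ}` (the output row «distance from the linear corrector»).
* ★★★ `exists_unique_exact_corrector_gauge` — `∃ ψ, ψ ∈ S ∧ p ψ ≤ 3C_L s ∧ ψ = L D + L (N ψ) ∧ ∀ ψ′ ∈ S, p ψ′ ≤ 3C_L s → ψ′ = L D + L (N ψ′) → ψ′ = ψ`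
  (Picard iterates from `0 = L 0 ∈ S`; `p (ψ_{n+1} − ψ_n) ≤ 3C_L s·2^{−n}`; `‖·‖ ≤ p` gives a Cauchy sequence in the instance norm (Mathlib `cauchySeq_of_le_geometric`),
  completeness a limit, `IsClosed S` membership, `p ≤ C_p‖·‖` the rows `p ψ ≤ 3C_L s` and `Φ ψ = ψ` (`tendsto_nhds_unique`); uniqueness from the contraction).
* ★★ `exists_unique_exact_corrector_gauge_univ` — the same with `S = univ` (when the `N`-row holds on the whole ball).
* (v1.1) ★★★ `exists_unique_exact_corrector_gauge_of_mapsTo` — the same door with `hLS` weakened to `0 ∈ S` + «`ψ ∈ S`, `p ψ ≤ 3C_L s` ⇒ `L D + L (N ψ) ∈ S`» (needed when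
  `S` = pinned ∧ Hermitian ∧ traceless and `Y` = all bond fields).
HONEST SCOPE.  Abstract; the door of record is the special case `p = q = ‖·‖`, `S = univ`, `C_p = 1` (not re-derived here).  The instantiation (`X` = site fields with the
tree's matrix norm via `letI`, `p` = the three sup rows, `Y` = bond fields, `q` = `max(ℓ·sup, ℓ²·sup D*_W)`, `L = LinCorr`, `N` = chart remainder) is the knit's (E1-e).

References: T. Bałaban, CMP 102 (1985) 277–309 [Balaban1985Variational] (Prop. 7 p.299); CMP 99 (1985) 75–102 [Balaban1985RegularSpaces] ((1.36) p.82).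
-/

set_option autoImplicit false

noncomputable section

open Filter Topology Set

namespace Summit.QuantumFields.YangMills.Theorems.Prop7ExactCorrectorContractionGauge

variable {X Y : Type*} [NormedAddCommGroup X] [AddCommGroup Y]

/-- A gauge squeezed between the norm and a multiple of the norm vanishes at `0`.  [cite: Balaban1985Variational, Prop. 7 p.299] -/
theorem gauge_zero (p : X → ℝ) {C_p : ℝ} (hp_norm : ∀ x, ‖x‖ ≤ p x) (hp_le : ∀ x, p x ≤ C_p * ‖x‖) : p 0 = 0 := by
  have h1 := hp_norm 0
  have h2 := hp_le 0
  rw [norm_zero] at h1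
  rw [norm_zero, mul_zero] at h2
  exact le_antisymm h2 h1

/-- A gauge dominating the norm is nonnegative.  [cite: Balaban1985Variational, Prop. 7 p.299] -/
theorem gauge_nonneg (p : X → ℝ) (hp_norm : ∀ x, ‖x‖ ≤ p x) (x : X) : 0 ≤ p x :=
  (norm_nonneg x).trans (hp_norm x)

/-- Subadditivity `p (a + b) ≤ p a + p b` from the three-point triangle inequality `p (a − c) ≤ p (a − b) + p (b − c)`.
[cite: Balaban1985Variational, Prop. 7 p.299] -/
theorem gauge_add_le (p : X → ℝ) (hp_tri : ∀ a b c : X, p (a - c) ≤ p (a - b) + p (b - c)) (a b : X) :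
    p (a + b) ≤ p a + p b := by
  have h := hp_tri (a + b) b 0
  simp only [sub_zero, add_sub_cancel_right] at h
  exact h

/-- The size of `N ψ` in `q`-gauge from the Lipschitz row at `ψ′ = 0` and `N 0 = 0`: `q (N ψ) ≤ C_N (p ψ + s)·p ψ` — the knit's output row for `‖N(ψ)‖_Y`.
[cite: Balaban1985Variational, Prop. 7 p.299] -/
theorem gauge_apply_N_le (S : Set X) (p : X → ℝ) (q : Y → ℝ) (N : X → Y) {C_N s ρ : ℝ} (hρ : 0 ≤ ρ) (hp0 : p 0 = 0)
    (h0S : (0 : X) ∈ S) (hN0 : N 0 = 0)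
    (hN : ∀ ψ ψ' : X, ψ ∈ S → ψ' ∈ S → p ψ ≤ ρ → p ψ' ≤ ρ → q (N ψ - N ψ') ≤ C_N * (p ψ + p ψ' + s) * p (ψ - ψ'))
    (ψ : X) (hψS : ψ ∈ S) (hψ : p ψ ≤ ρ) : q (N ψ) ≤ C_N * (p ψ + s) * p ψ := by
  have h := hN ψ 0 hψS h0S hψ (by rw [hp0]; exact hρ)
  rw [hN0, sub_zero, hp0, add_zero, sub_zero] at h
  exact h

/-- Output row for the knit: a solution `ψ = L D + L (N ψ)` in `S ∩ {p ≤ ρ}` lies within `p`-distance `C_L·C_N·(ρ + s)·ρ` of the LINEAR corrector `L D`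
(`p (ψ − L D) = p (L (N ψ)) ≤ C_L·q (N ψ)`).  [cite: Balaban1985Variational, Prop. 7 p.299] -/
theorem gauge_sub_linear_le (S : Set X) (p : X → ℝ) (q : Y → ℝ) (L : Y →+ X) (N : X → Y) (D : Y) {C_L C_N s ρ : ℝ}
    (hCL : 0 ≤ C_L) (hCN : 0 ≤ C_N) (hs : 0 ≤ s) (hρ : 0 ≤ ρ) (hp0 : p 0 = 0) (hpnn : ∀ x, 0 ≤ p x) (h0S : (0 : X) ∈ S)
    (hL : ∀ y, p (L y) ≤ C_L * q y) (hN0 : N 0 = 0)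
    (hN : ∀ ψ ψ' : X, ψ ∈ S → ψ' ∈ S → p ψ ≤ ρ → p ψ' ≤ ρ → q (N ψ - N ψ') ≤ C_N * (p ψ + p ψ' + s) * p (ψ - ψ'))
    (ψ : X) (hψS : ψ ∈ S) (hψ : p ψ ≤ ρ) (hfix : ψ = L D + L (N ψ)) :
    p (ψ - L D) ≤ C_L * C_N * (ρ + s) * ρ := by
  have e : ψ - L D = L (N ψ) := by
    have h1 : L D + L (N ψ) - L D = L (N ψ) := add_sub_cancel_left _ _
    rw [← hfix] at h1
    exact h1
  rw [e]
  have h := gauge_apply_N_le S p q N hρ hp0 h0S hN0 hN ψ hψS hψ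
  have hpψ := hpnn ψ
  calc p (L (N ψ)) ≤ C_L * q (N ψ) := hL _
    _ ≤ C_L * (C_N * (p ψ + s) * p ψ) := by gcongr
    _ ≤ C_L * (C_N * (ρ + s) * ρ) := by gcongr
    _ = C_L * C_N * (ρ + s) * ρ := by ring

/-- ★★★ **THE EXACT CORRECTOR BY CONTRACTION, GAUGE CURRENCY (instance-free twin of `Prop7ExactCorrectorContraction.exists_unique_exact_corrector`).**
`X` a complete normed additive group (its norm is used only for the limit), `Y` an additive group; gauges `p : X → ℝ`, `q : Y → ℝ` with `p (a − c) ≤ p (a − b) + p (b − c)`,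
`‖x‖ ≤ p x ≤ C_p‖x‖`; `S ⊆ X` closed; `L : Y →+ X` with `L y ∈ S` and `p (L y) ≤ C_L·q y`; `N : X → Y` with `N 0 = 0` and
`q (N ψ − N ψ′) ≤ C_N (p ψ + p ψ′ + s)·p (ψ − ψ′)` for `ψ, ψ′ ∈ S` with `p ψ, p ψ′ ≤ 3C_L s`; data `q D ≤ s`; `0 ≤ s, C_L, C_N`; window `C_L·C_N·(7C_L s + s) ≤ 1∕2`.
Then there is exactly one `ψ ∈ S` with `p ψ ≤ 3C_L s` and `ψ = L D + L (N ψ)`.  [cite: Balaban1985Variational, Prop. 7 p.299] -/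
theorem exists_unique_exact_corrector_gauge [CompleteSpace X] (S : Set X) (p : X → ℝ) (q : Y → ℝ) (L : Y →+ X) (N : X → Y) (D : Y)
    {C_p C_L C_N s : ℝ} (hCL : 0 ≤ C_L) (hCN : 0 ≤ C_N) (hs : 0 ≤ s)
    (hp_tri : ∀ a b c : X, p (a - c) ≤ p (a - b) + p (b - c))
    (hp_norm : ∀ x, ‖x‖ ≤ p x) (hp_le : ∀ x, p x ≤ C_p * ‖x‖)
    (hS : IsClosed S) (hLS : ∀ y, L y ∈ S) (hL : ∀ y, p (L y) ≤ C_L * q y) (hN0 : N 0 = 0)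
    (hN : ∀ ψ ψ' : X, ψ ∈ S → ψ' ∈ S → p ψ ≤ 3 * C_L * s → p ψ' ≤ 3 * C_L * s →
      q (N ψ - N ψ') ≤ C_N * (p ψ + p ψ' + s) * p (ψ - ψ'))
    (hD : q D ≤ s) (hwin : C_L * C_N * (7 * C_L * s + s) ≤ 1 / 2) :
    ∃ ψ : X, ψ ∈ S ∧ p ψ ≤ 3 * C_L * s ∧ ψ = L D + L (N ψ) ∧
      ∀ ψ' : X, ψ' ∈ S → p ψ' ≤ 3 * C_L * s → ψ' = L D + L (N ψ') → ψ' = ψ := by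
  set ρ : ℝ := 3 * C_L * s with hρ
  have hρ0 : 0 ≤ ρ := by positivity
  have hp0 : p 0 = 0 := gauge_zero p hp_norm hp_le
  have hpnn : ∀ x, 0 ≤ p x := gauge_nonneg p hp_norm
  have h0S : (0 : X) ∈ S := by simpa using hLS 0
  set Φ : X → X := fun ψ => L D + L (N ψ) with hΦ
  -- size of `N ψ` on `S ∩ {p ≤ ρ}`
  have hNψ : ∀ ψ, ψ ∈ S → p ψ ≤ ρ → q (N ψ) ≤ C_N * (ρ + s) * ρ := by
    intro ψ hψS hψ
    have h := gauge_apply_N_le S p q N hρ0 hp0 h0S hN0 hN ψ hψS hψ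
    have hpψ := hpnn ψ
    calc q (N ψ) ≤ C_N * (p ψ + s) * p ψ := h
      _ ≤ C_N * (ρ + s) * ρ := by gcongr
  -- the numeric heart of the window
  have hq : C_L * C_N * (ρ + s) ≤ 1 / 2 := by
    have h7 : ρ + s ≤ 7 * C_L * s + s := by rw [hρ]; nlinarith
    have hCC : 0 ≤ C_L * C_N := mul_nonneg hCL hCN
    calc C_L * C_N * (ρ + s) ≤ C_L * C_N * (7 * C_L * s + s) := by gcongr
      _ ≤ 1 / 2 := hwin
  -- Φ lands in S and maps `S ∩ {p ≤ ρ}` into `{p ≤ ρ}`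
  have hmapsS : ∀ ψ, Φ ψ ∈ S := by
    intro ψ
    show L D + L (N ψ) ∈ S
    rw [← map_add]
    exact hLS _
  have hmaps : ∀ ψ, ψ ∈ S → p ψ ≤ ρ → p (Φ ψ) ≤ ρ := by
    intro ψ hψS hψ
    have hqD : q D ≤ s := hD
    calc p (Φ ψ) = p (L D + L (N ψ)) := rfl
      _ ≤ p (L D) + p (L (N ψ)) := gauge_add_le p hp_tri _ _
      _ ≤ C_L * q D + C_L * q (N ψ) := add_le_add (hL D) (hL (N ψ))
      _ ≤ C_L * s + C_L * (C_N * (ρ + s) * ρ) := by gcongr; exact hNψ ψ hψS hψ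
      _ = C_L * s + (C_L * C_N * (ρ + s)) * ρ := by ring
      _ ≤ C_L * s + (1 / 2) * ρ := by gcongr
      _ ≤ ρ := by rw [hρ]; nlinarith
  -- Φ is a `1/2`-contraction in `p`-gauge on `S ∩ {p ≤ ρ}`
  have hlip : ∀ ψ ψ', ψ ∈ S → ψ' ∈ S → p ψ ≤ ρ → p ψ' ≤ ρ →
      p (Φ ψ - Φ ψ') ≤ (1 / 2) * p (ψ - ψ') := by
    intro ψ ψ' hψS hψ'S hψ hψ'
    have e : Φ ψ - Φ ψ' = L (N ψ - N ψ') := by simp only [hΦ, map_sub]; abel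
    rw [e]
    have hpd := hpnn (ψ - ψ')
    have hsum : p ψ + p ψ' + s ≤ 7 * C_L * s + s := by rw [hρ] at hψ hψ'; nlinarith
    have hCC : 0 ≤ C_L * C_N := mul_nonneg hCL hCN
    calc p (L (N ψ - N ψ')) ≤ C_L * q (N ψ - N ψ') := hL _
      _ ≤ C_L * (C_N * (p ψ + p ψ' + s) * p (ψ - ψ')) := by gcongr; exact hN ψ ψ' hψS hψ'S hψ hψ'
      _ = (C_L * C_N * (p ψ + p ψ' + s)) * p (ψ - ψ') := by ring
      _ ≤ (C_L * C_N * (7 * C_L * s + s)) * p (ψ - ψ') := by gcongr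
      _ ≤ (1 / 2) * p (ψ - ψ') := by gcongr
  -- Picard iteration from `0`
  set u : ℕ → X := fun n => Φ^[n] 0 with hu
  have hu0 : u 0 = 0 := rfl
  have husucc : ∀ n, u (n + 1) = Φ (u n) := fun n => Function.iterate_succ_apply' Φ n 0
  have huS : ∀ n, u n ∈ S := by
    intro n
    induction n with
    | zero => rw [hu0]; exact h0S
    | succ n _ => rw [husucc]; exact hmapsS _
  have huρ : ∀ n, p (u n) ≤ ρ := by
    intro n
    induction n with
    | zero => rw [hu0, hp0]; exact hρ0
    | succ n ih => rw [husucc]; exact hmaps _ (huS n) ih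
  have hstep : ∀ n, p (u (n + 1) - u n) ≤ ρ * (1 / 2) ^ n := by
    intro n
    induction n with
    | zero => rw [pow_zero, mul_one, hu0, sub_zero]; exact huρ 1
    | succ n ih =>
        have ih' : p (Φ (u n) - u n) ≤ ρ * (1 / 2) ^ n := by rw [← husucc]; exact ih
        rw [husucc (n + 1), husucc n]
        calc p (Φ (Φ (u n)) - Φ (u n)) ≤ (1 / 2) * p (Φ (u n) - u n) :=
              hlip _ _ (hmapsS _) (huS n) (hmaps _ (huS n) (huρ n)) (huρ n)
          _ ≤ (1 / 2) * (ρ * (1 / 2) ^ n) := by gcongr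
          _ = ρ * (1 / 2) ^ (n + 1) := by ring
  -- Cauchy in the instance norm, hence convergent
  have hdist : ∀ n, dist (u n) (u (n + 1)) ≤ ρ * (1 / 2) ^ n := by
    intro n
    rw [dist_comm, dist_eq_norm]
    exact (hp_norm _).trans (hstep n)
  have hcauchy : CauchySeq u := cauchySeq_of_le_geometric (1 / 2) ρ (by norm_num) hdist
  obtain ⟨ψ, hψ⟩ := cauchySeq_tendsto_of_complete hcauchy
  have hψS : ψ ∈ S := hS.mem_of_tendsto hψ (Eventually.of_forall huS)
  -- the gauge distance to the limit tends to zero (continuity of `p` w.r.t. the norm)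
  have hnorm : Tendsto (fun n => ‖u n - ψ‖) atTop (𝓝 0) := tendsto_iff_norm_sub_tendsto_zero.1 hψ
  have hpconv : Tendsto (fun n => p (ψ - u n)) atTop (𝓝 0) := by
    have hC : Tendsto (fun n => C_p * ‖u n - ψ‖) atTop (𝓝 0) := by simpa using hnorm.const_mul C_p
    refine squeeze_zero (fun n => hpnn _) (fun n => ?_) hC
    calc p (ψ - u n) ≤ C_p * ‖ψ - u n‖ := hp_le _
      _ = C_p * ‖u n - ψ‖ := by rw [norm_sub_rev]
  -- `p ψ ≤ ρ`
  have hψρ : p ψ ≤ ρ := by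
    have hb : ∀ n, p ψ ≤ p (ψ - u n) + ρ := by
      intro n
      have h := hp_tri ψ (u n) 0
      rw [sub_zero, sub_zero] at h
      linarith [huρ n]
    have hlim : Tendsto (fun n => p (ψ - u n) + ρ) atTop (𝓝 (0 + ρ)) := hpconv.add tendsto_const_nhds
    rw [zero_add] at hlim
    exact ge_of_tendsto' hlim hb
  -- `Φ ψ = ψ`
  have hfix : Φ ψ = ψ := by
    have h1 : Tendsto (fun n => u (n + 1)) atTop (𝓝 ψ) := hψ.comp (tendsto_add_atTop_nat 1)
    have h2 : Tendsto (fun n => u (n + 1)) atTop (𝓝 (Φ ψ)) := by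
      refine tendsto_iff_norm_sub_tendsto_zero.2 ?_
      have hC : Tendsto (fun n => (1 / 2) * (C_p * ‖u n - ψ‖)) atTop (𝓝 0) := by
        simpa using (hnorm.const_mul C_p).const_mul (1 / 2 : ℝ)
      refine squeeze_zero (fun n => norm_nonneg _) (fun n => ?_) hC
      rw [husucc]
      calc ‖Φ (u n) - Φ ψ‖ ≤ p (Φ (u n) - Φ ψ) := hp_norm _
        _ ≤ (1 / 2) * p (u n - ψ) := hlip _ _ (huS n) hψS (huρ n) hψρ
        _ ≤ (1 / 2) * (C_p * ‖u n - ψ‖) := by gcongr; exact hp_le _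
    exact tendsto_nhds_unique h2 h1
  refine ⟨ψ, hψS, hψρ, hfix.symm, ?_⟩
  -- uniqueness in `S ∩ {p ≤ ρ}`
  intro ψ' hψ'S hψ' hfix'
  have h := hlip ψ' ψ hψ'S hψS hψ' hψρ
  have e1 : Φ ψ' = ψ' := by
    show L D + L (N ψ') = ψ'
    exact hfix'.symm
  rw [e1, hfix] at h
  have hpd := hpnn (ψ' - ψ)
  have hp0' : p (ψ' - ψ) ≤ 0 := by linarith
  have hn : ‖ψ' - ψ‖ ≤ 0 := (hp_norm _).trans hp0'
  have hn0 : ‖ψ' - ψ‖ = 0 := le_antisymm hn (norm_nonneg _)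
  exact sub_eq_zero.mp (norm_eq_zero.mp hn0)

/-- ★★ **The same with `S = univ`**: when the `N`-Lipschitz row holds on the whole `p`-ball (no invariant subset needed), there is exactly one `ψ` with `p ψ ≤ 3C_L s` and
`ψ = L D + L (N ψ)`.  [cite: Balaban1985Variational, Prop. 7 p.299] -/
theorem exists_unique_exact_corrector_gauge_univ [CompleteSpace X] (p : X → ℝ) (q : Y → ℝ) (L : Y →+ X) (N : X → Y) (D : Y)
    {C_p C_L C_N s : ℝ} (hCL : 0 ≤ C_L) (hCN : 0 ≤ C_N) (hs : 0 ≤ s)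
    (hp_tri : ∀ a b c : X, p (a - c) ≤ p (a - b) + p (b - c))
    (hp_norm : ∀ x, ‖x‖ ≤ p x) (hp_le : ∀ x, p x ≤ C_p * ‖x‖)
    (hL : ∀ y, p (L y) ≤ C_L * q y) (hN0 : N 0 = 0)
    (hN : ∀ ψ ψ' : X, p ψ ≤ 3 * C_L * s → p ψ' ≤ 3 * C_L * s → q (N ψ - N ψ') ≤ C_N * (p ψ + p ψ' + s) * p (ψ - ψ'))
    (hD : q D ≤ s) (hwin : C_L * C_N * (7 * C_L * s + s) ≤ 1 / 2) :
    ∃ ψ : X, p ψ ≤ 3 * C_L * s ∧ ψ = L D + L (N ψ) ∧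
      ∀ ψ' : X, p ψ' ≤ 3 * C_L * s → ψ' = L D + L (N ψ') → ψ' = ψ := by
  obtain ⟨ψ, -, hψρ, hfix, huniq⟩ := exists_unique_exact_corrector_gauge (Set.univ : Set X) p q L N D hCL hCN hs hp_tri hp_norm hp_le
    isClosed_univ (fun _ => Set.mem_univ _) hL hN0 (fun ψ ψ' _ _ hψ hψ' => hN ψ ψ' hψ hψ') hD hwin
  exact ⟨ψ, hψρ, hfix, fun ψ' hψ' hfix' => huniq ψ' (Set.mem_univ _) hψ' hfix'⟩

/-! ## v1.1 — the door with the MINIMAL invariance hypothesis (the Hermitian-traceless set) -/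

/-- ★★★ **THE EXACT CORRECTOR BY CONTRACTION, GAUGE CURRENCY — `S`-INVARIANCE ASKED ONLY ALONG THE ITERATION** (v1.1).  Same as
`exists_unique_exact_corrector_gauge`, but instead of `hLS : ∀ y, L y ∈ S` (too strong when `S` carries the reality conditions «Hermitian, traceless» and `Y` is the type of ALL bond
fields) the hypotheses are `h0S : 0 ∈ S` and `hΦS : ∀ ψ ∈ S, p ψ ≤ 3C_L s → L D + L (N ψ) ∈ S` — i.e. the Picard map sends `S ∩ {p ≤ 3C_L s}` into `S` (for the knit: `D` and `N ψ`
are Hermitian-type for Hermitian pinned `ψ`, and `LinCorr` preserves reality — ✓ `Prop7LinearCorrectorT3` + the star∕trace commutation of `Δ_W`).  Conclusion unchanged.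
[cite: Balaban1985Variational, Prop. 7 p.299] -/
theorem exists_unique_exact_corrector_gauge_of_mapsTo [CompleteSpace X] (S : Set X) (p : X → ℝ) (q : Y → ℝ) (L : Y →+ X) (N : X → Y) (D : Y)
    {C_p C_L C_N s : ℝ} (hCL : 0 ≤ C_L) (hCN : 0 ≤ C_N) (hs : 0 ≤ s)
    (hp_tri : ∀ a b c : X, p (a - c) ≤ p (a - b) + p (b - c))
    (hp_norm : ∀ x, ‖x‖ ≤ p x) (hp_le : ∀ x, p x ≤ C_p * ‖x‖)
    (hS : IsClosed S) (h0S : (0 : X) ∈ S) (hΦS : ∀ ψ : X, ψ ∈ S → p ψ ≤ 3 * C_L * s → L D + L (N ψ) ∈ S)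
    (hL : ∀ y, p (L y) ≤ C_L * q y) (hN0 : N 0 = 0)
    (hN : ∀ ψ ψ' : X, ψ ∈ S → ψ' ∈ S → p ψ ≤ 3 * C_L * s → p ψ' ≤ 3 * C_L * s →
      q (N ψ - N ψ') ≤ C_N * (p ψ + p ψ' + s) * p (ψ - ψ'))
    (hD : q D ≤ s) (hwin : C_L * C_N * (7 * C_L * s + s) ≤ 1 / 2) :
    ∃ ψ : X, ψ ∈ S ∧ p ψ ≤ 3 * C_L * s ∧ ψ = L D + L (N ψ) ∧
      ∀ ψ' : X, ψ' ∈ S → p ψ' ≤ 3 * C_L * s → ψ' = L D + L (N ψ') → ψ' = ψ := by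
  set ρ : ℝ := 3 * C_L * s with hρ
  have hρ0 : 0 ≤ ρ := by positivity
  have hp0 : p 0 = 0 := gauge_zero p hp_norm hp_le
  have hpnn : ∀ x, 0 ≤ p x := gauge_nonneg p hp_norm
  set Φ : X → X := fun ψ => L D + L (N ψ) with hΦ
  -- size of `N ψ` on `S ∩ {p ≤ ρ}`
  have hNψ : ∀ ψ, ψ ∈ S → p ψ ≤ ρ → q (N ψ) ≤ C_N * (ρ + s) * ρ := by
    intro ψ hψS hψ
    have h := gauge_apply_N_le S p q N hρ0 hp0 h0S hN0 hN ψ hψS hψ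
    have hpψ := hpnn ψ
    calc q (N ψ) ≤ C_N * (p ψ + s) * p ψ := h
      _ ≤ C_N * (ρ + s) * ρ := by gcongr
  -- the numeric heart of the window
  have hq : C_L * C_N * (ρ + s) ≤ 1 / 2 := by
    have h7 : ρ + s ≤ 7 * C_L * s + s := by rw [hρ]; nlinarith
    have hCC : 0 ≤ C_L * C_N := mul_nonneg hCL hCN
    calc C_L * C_N * (ρ + s) ≤ C_L * C_N * (7 * C_L * s + s) := by gcongr
      _ ≤ 1 / 2 := hwin
  -- Φ lands in S and maps `S ∩ {p ≤ ρ}` into `{p ≤ ρ}`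
  have hmapsS : ∀ ψ, ψ ∈ S → p ψ ≤ ρ → Φ ψ ∈ S := fun ψ hψS hψ => hΦS ψ hψS hψ
  have hmaps : ∀ ψ, ψ ∈ S → p ψ ≤ ρ → p (Φ ψ) ≤ ρ := by
    intro ψ hψS hψ
    have hqD : q D ≤ s := hD
    calc p (Φ ψ) = p (L D + L (N ψ)) := rfl
      _ ≤ p (L D) + p (L (N ψ)) := gauge_add_le p hp_tri _ _
      _ ≤ C_L * q D + C_L * q (N ψ) := add_le_add (hL D) (hL (N ψ))
      _ ≤ C_L * s + C_L * (C_N * (ρ + s) * ρ) := by gcongr; exact hNψ ψ hψS hψ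
      _ = C_L * s + (C_L * C_N * (ρ + s)) * ρ := by ring
      _ ≤ C_L * s + (1 / 2) * ρ := by gcongr
      _ ≤ ρ := by rw [hρ]; nlinarith
  -- Φ is a `1/2`-contraction in `p`-gauge on `S ∩ {p ≤ ρ}`
  have hlip : ∀ ψ ψ', ψ ∈ S → ψ' ∈ S → p ψ ≤ ρ → p ψ' ≤ ρ →
      p (Φ ψ - Φ ψ') ≤ (1 / 2) * p (ψ - ψ') := by
    intro ψ ψ' hψS hψ'S hψ hψ'
    have e : Φ ψ - Φ ψ' = L (N ψ - N ψ') := by simp only [hΦ, map_sub]; abel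
    rw [e]
    have hpd := hpnn (ψ - ψ')
    have hsum : p ψ + p ψ' + s ≤ 7 * C_L * s + s := by rw [hρ] at hψ hψ'; nlinarith
    have hCC : 0 ≤ C_L * C_N := mul_nonneg hCL hCN
    calc p (L (N ψ - N ψ')) ≤ C_L * q (N ψ - N ψ') := hL _
      _ ≤ C_L * (C_N * (p ψ + p ψ' + s) * p (ψ - ψ')) := by gcongr; exact hN ψ ψ' hψS hψ'S hψ hψ'
      _ = (C_L * C_N * (p ψ + p ψ' + s)) * p (ψ - ψ') := by ring
      _ ≤ (C_L * C_N * (7 * C_L * s + s)) * p (ψ - ψ') := by gcongr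
      _ ≤ (1 / 2) * p (ψ - ψ') := by gcongr
  -- Picard iteration from `0`
  set u : ℕ → X := fun n => Φ^[n] 0 with hu
  have hu0 : u 0 = 0 := rfl
  have husucc : ∀ n, u (n + 1) = Φ (u n) := fun n => Function.iterate_succ_apply' Φ n 0
  have huSρ : ∀ n, u n ∈ S ∧ p (u n) ≤ ρ := by
    intro n
    induction n with
    | zero => rw [hu0, hp0]; exact ⟨h0S, hρ0⟩
    | succ n ih => rw [husucc]; exact ⟨hmapsS _ ih.1 ih.2, hmaps _ ih.1 ih.2⟩
  have huS : ∀ n, u n ∈ S := fun n => (huSρ n).1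
  have huρ : ∀ n, p (u n) ≤ ρ := fun n => (huSρ n).2
  have hstep : ∀ n, p (u (n + 1) - u n) ≤ ρ * (1 / 2) ^ n := by
    intro n
    induction n with
    | zero => rw [pow_zero, mul_one, hu0, sub_zero]; exact huρ 1
    | succ n ih =>
        have ih' : p (Φ (u n) - u n) ≤ ρ * (1 / 2) ^ n := by rw [← husucc]; exact ih
        rw [husucc (n + 1), husucc n]
        calc p (Φ (Φ (u n)) - Φ (u n)) ≤ (1 / 2) * p (Φ (u n) - u n) :=
              hlip _ _ (hmapsS _ (huS n) (huρ n)) (huS n) (hmaps _ (huS n) (huρ n)) (huρ n)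
          _ ≤ (1 / 2) * (ρ * (1 / 2) ^ n) := by gcongr
          _ = ρ * (1 / 2) ^ (n + 1) := by ring
  -- Cauchy in the instance norm, hence convergent
  have hdist : ∀ n, dist (u n) (u (n + 1)) ≤ ρ * (1 / 2) ^ n := by
    intro n
    rw [dist_comm, dist_eq_norm]
    exact (hp_norm _).trans (hstep n)
  have hcauchy : CauchySeq u := cauchySeq_of_le_geometric (1 / 2) ρ (by norm_num) hdist
  obtain ⟨ψ, hψ⟩ := cauchySeq_tendsto_of_complete hcauchy
  have hψS : ψ ∈ S := hS.mem_of_tendsto hψ (Eventually.of_forall huS)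
  -- the gauge distance to the limit tends to zero (continuity of `p` w.r.t. the norm)
  have hnorm : Tendsto (fun n => ‖u n - ψ‖) atTop (𝓝 0) := tendsto_iff_norm_sub_tendsto_zero.1 hψ
  have hpconv : Tendsto (fun n => p (ψ - u n)) atTop (𝓝 0) := by
    have hC : Tendsto (fun n => C_p * ‖u n - ψ‖) atTop (𝓝 0) := by simpa using hnorm.const_mul C_p
    refine squeeze_zero (fun n => hpnn _) (fun n => ?_) hC
    calc p (ψ - u n) ≤ C_p * ‖ψ - u n‖ := hp_le _
      _ = C_p * ‖u n - ψ‖ := by rw [norm_sub_rev]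
  -- `p ψ ≤ ρ`
  have hψρ : p ψ ≤ ρ := by
    have hb : ∀ n, p ψ ≤ p (ψ - u n) + ρ := by
      intro n
      have h := hp_tri ψ (u n) 0
      rw [sub_zero, sub_zero] at h
      linarith [huρ n]
    have hlim : Tendsto (fun n => p (ψ - u n) + ρ) atTop (𝓝 (0 + ρ)) := hpconv.add tendsto_const_nhds
    rw [zero_add] at hlim
    exact ge_of_tendsto' hlim hb
  -- `Φ ψ = ψ`
  have hfix : Φ ψ = ψ := by
    have h1 : Tendsto (fun n => u (n + 1)) atTop (𝓝 ψ) := hψ.comp (tendsto_add_atTop_nat 1)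
    have h2 : Tendsto (fun n => u (n + 1)) atTop (𝓝 (Φ ψ)) := by
      refine tendsto_iff_norm_sub_tendsto_zero.2 ?_
      have hC : Tendsto (fun n => (1 / 2) * (C_p * ‖u n - ψ‖)) atTop (𝓝 0) := by
        simpa using (hnorm.const_mul C_p).const_mul (1 / 2 : ℝ)
      refine squeeze_zero (fun n => norm_nonneg _) (fun n => ?_) hC
      rw [husucc]
      calc ‖Φ (u n) - Φ ψ‖ ≤ p (Φ (u n) - Φ ψ) := hp_norm _
        _ ≤ (1 / 2) * p (u n - ψ) := hlip _ _ (huS n) hψS (huρ n) hψρ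
        _ ≤ (1 / 2) * (C_p * ‖u n - ψ‖) := by gcongr; exact hp_le _
    exact tendsto_nhds_unique h2 h1
  refine ⟨ψ, hψS, hψρ, hfix.symm, ?_⟩
  -- uniqueness in `S ∩ {p ≤ ρ}`
  intro ψ' hψ'S hψ' hfix'
  have h := hlip ψ' ψ hψ'S hψS hψ' hψρ
  have e1 : Φ ψ' = ψ' := by
    show L D + L (N ψ') = ψ'
    exact hfix'.symm
  rw [e1, hfix] at h
  have hpd := hpnn (ψ' - ψ)
  have hp0' : p (ψ' - ψ) ≤ 0 := by linarith
  have hn : ‖ψ' - ψ‖ ≤ 0 := (hp_norm _).trans hp0'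
  have hn0 : ‖ψ' - ψ‖ = 0 := le_antisymm hn (norm_nonneg _)
  exact sub_eq_zero.mp (norm_eq_zero.mp hn0)

end Summit.QuantumFields.YangMills.Theorems.Prop7ExactCorrectorContractionGauge
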